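import Mathlib.NumberTheory.Padics.ValuativeRel
import Mathlib.FieldTheory.Minpoly.Field
import Mathlib.RingTheory.IntegralClosure.Algebra.Basic
import Mathlib.Algebra.Polynomial.AlgebraMap
import Mathlib.Algebra.Order.GroupWithZero.Basic
import Literature.AlgebraicGeometry.Frobenioids.PadicFrobenioidZero
import HarnessLib

/-!
# Frobenioids II, proof of Thm. 1.2 (i): endomorphisms of the base act trivially on `Φ₀ = ord(O^⊳) ⊗ ℝ_{≥0}`
# — valuative field endomorphisms of a finite extension of `ℚ_p` preserve the valuation (PROOFS)

Mochizuki, *The geometry of Frobenioids II*, Kyushu J. Math. **62** (2008) 401–460, §1, proof of Theorem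
1.2 (i), p. 9: "Since, for `A_D ∈ Ob(D)`, the monoid `End_D(A_D)` acts trivially on `Φ(A_D)`, it follows
immediately from the construction of a model Frobenioid … that `C` is of `Aut`-ample, `Aut^sub`-ample,
and `End`-ample type" [cite: MochizukiFrdII2008, Thm 1.2 (i) p.9]. The sentence rests on the following
arithmetic fact about the base `D₀` ("`Spec(K)`, `K` a finite extension of `ℚ_p`", Ex. 1.1 (i) p. 7): an
endomorphism `Spec K → Spec K` of `D₀`, i.e. a valuative ring endomorphism `σ` of `K`, PRESERVES the
valuation, hence acts as the identity on `ord(O_K^⊳) = O_K^⊳/O_K^×` and on `Φ₀(Spec K) = ord(O_K^⊳)^rlf`.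

We prove it for the objects of abc-iut-L1-t4's base category `PadicFld p` under the standing hypothesis
of print in the unbundled form of t4's `PadicFld.IsPadicLocal` — `K` carries a finite `ℚ_p`-algebra
structure along which the valuative relation of `K` restricts to the `p`-adic one:
* `valuation_algebraMap_eq_zpow`: for `c ∈ ℚ_p^×`, `v_K(c) = v_K(p)^{ord_p(c)}`;
* `exists_pow_valuation_eq_zpow` ("finite index of value groups", elementary form): for `x ∈ K^×` there
  are `n ≥ 1` and `k ∈ ℤ` with `v_K(x)^n = v_K(p)^k` — from the minimal polynomial of `x` over `ℚ_p`: in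
  `∑ c_i x^i = 0` two distinct terms have the same (maximal) valuation (ultrametric inequality);
* `valuation_map_eq_of_isValHom`: a ring endomorphism `σ` of `K` with `a ≤ᵥ b ↔ σ a ≤ᵥ σ b` satisfies
  `v_K(σ x) = v_K(x)` — since `x^n` and `p^k` have the same valuation, so do `σ(x)^n` and `σ(p^k) = p^k`,
  and `n`-th roots are unique in the linearly ordered value group;
* `PadicFld.ordIntMapOfHom_eq_id`, `PadicFld.phiZero_map_eq_id`: consequently `σ` acts as the identity on
  `ord(O_K^⊳)` and `Φ₀.map σ = id` — the hypothesis `hT` of `PadicFrobenioidThm12TypesProofs.lean`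
  (seat abc-iut-L1-d10), making the `Aut`-ample / `Aut^sub`-ample clauses of Thm. 1.2 (i) unconditional for
  data whose base objects are finite extensions of `ℚ_p` (t4's `Datum.isPadicLocal`).
PROOF-ONLY (no definitions); imports only landed modules and Mathlib.
-/

namespace Literature.AlgebraicGeometry.Frobenioids

namespace PadicFrd

open CategoryTheory Opposite ValuativeRel Polynomial

universe u

section PadicLocal

open scoped Classical in
/-- Unfolding of Mathlib's bundled `p`-adic valuation `Padic.mulValuation` (definitional).
[cite: MochizukiFrdII2008, Ex 1.1 (i) p.7] -/
theorem padic_mulValuation_eq {p : ℕ} [Fact p.Prime] (c : ℚ_[p]) :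
    Padic.mulValuation c = if c = 0 then 0 else WithZero.exp (-c.valuation) := rfl

variable {p : ℕ} [Fact p.Prime] {K : Type u} [Field K] [ValuativeRel K] [Algebra ℚ_[p] K]

/-- Along a `ℚ_p`-algebra structure compatible with the valuative relations, elements of `ℚ_p` with the
same `p`-adic valuation have the same valuation in `K`. [cite: MochizukiFrdII2008, Ex 1.1 (i) p.7] -/
theorem valuation_algebraMap_eq_of_mulValuation_eq
    (hc : ∀ a b : ℚ_[p], algebraMap ℚ_[p] K a ≤ᵥ algebraMap ℚ_[p] K b ↔ a ≤ᵥ b) {a b : ℚ_[p]}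
    (h : Padic.mulValuation a = Padic.mulValuation b) :
    valuation K (algebraMap ℚ_[p] K a) = valuation K (algebraMap ℚ_[p] K b) := by
  rw [← Valuation.veq_iff_eq] at h ⊢
  rw [veq_def] at h ⊢
  exact ⟨(hc a b).mpr h.1, (hc b a).mpr h.2⟩

/-- `v_K(c) = v_K(p)^{ord_p(c)}` for `c ∈ ℚ_p^×`: `c` and `p^{ord_p c}` have the same `p`-adic valuation.
[cite: MochizukiFrdII2008, Ex 1.1 (i) p.7] -/
theorem valuation_algebraMap_eq_zpow
    (hc : ∀ a b : ℚ_[p], algebraMap ℚ_[p] K a ≤ᵥ algebraMap ℚ_[p] K b ↔ a ≤ᵥ b) {c : ℚ_[p]} (h0 : c ≠ 0) :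
    valuation K (algebraMap ℚ_[p] K c) = valuation K ((p : ℕ) : K) ^ c.valuation := by
  have hp0 : ((p : ℕ) : ℚ_[p]) ≠ 0 := Nat.cast_ne_zero.mpr (Fact.out : p.Prime).ne_zero
  have h : Padic.mulValuation c = Padic.mulValuation (((p : ℕ) : ℚ_[p]) ^ c.valuation) := by
    rw [padic_mulValuation_eq, padic_mulValuation_eq, if_neg h0, if_neg (zpow_ne_zero _ hp0),
      Padic.valuation_zpow, Padic.valuation_p, mul_one]
  rw [valuation_algebraMap_eq_of_mulValuation_eq hc h, map_zpow₀, map_natCast, map_zpow₀]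

omit [ValuativeRel K] in
/-- `p ≠ 0` in `K` (`K` is a `ℚ_p`-algebra and a field). [cite: MochizukiFrdII2008, Ex 1.1 (i) p.7] -/
theorem natCast_p_ne_zero : ((p : ℕ) : K) ≠ 0 := by
  rw [← map_natCast (algebraMap ℚ_[p] K), _root_.map_ne_zero]
  exact Nat.cast_ne_zero.mpr (Fact.out : p.Prime).ne_zero

variable [Module.Finite ℚ_[p] K]

/-- **"Finite index of the value group"** (elementary form): for `x ∈ K^×`, `K` finite over `ℚ_p` with
compatible valuative relation, some power `v_K(x)^n` (`n ≥ 1`) is an integral power of `v_K(p)`. Proof: in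
the minimal equation `∑ c_i x^i = 0` of `x` over `ℚ_p` two distinct terms `c_i x^i`, `c_j x^j` have the same
valuation (otherwise the sum has the valuation of its unique largest term, which is nonzero), and
`v_K(c_i), v_K(c_j)` are integral powers of `v_K(p)`. [cite: MochizukiFrdII2008, Thm 1.2 (i) p.9] -/
theorem exists_pow_valuation_eq_zpow
    (hc : ∀ a b : ℚ_[p], algebraMap ℚ_[p] K a ≤ᵥ algebraMap ℚ_[p] K b ↔ a ≤ᵥ b) {x : K} (hx : x ≠ 0) :
    ∃ n : ℕ, 0 < n ∧ ∃ k : ℤ, valuation K x ^ n = valuation K ((p : ℕ) : K) ^ k := by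
  classical
  set f : ℚ_[p][X] := minpoly ℚ_[p] x with hf
  have hint : _root_.IsIntegral ℚ_[p] x := Algebra.IsIntegral.isIntegral x
  have hmonic : f.Monic := minpoly.monic hint
  -- the terms of the minimal equation
  set t : ℕ → K := fun i => algebraMap ℚ_[p] K (f.coeff i) * x ^ i with ht
  set s : Finset ℕ := Finset.range (f.natDegree + 1) with hs
  have hsum : ∑ i ∈ s, t i = 0 := by
    have h := minpoly.aeval ℚ_[p] x
    rw [aeval_eq_sum_range] at h
    simpa only [Algebra.smul_def] using h
  have hd : f.natDegree ∈ s := by rw [hs, Finset.mem_range]; exact Nat.lt_succ_self _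
  have htd : valuation K (t f.natDegree) ≠ 0 := by
    rw [ht]
    simp only [hmonic.coeff_natDegree, map_one, one_mul, map_pow]
    exact pow_ne_zero _ ((Valuation.ne_zero_iff _).mpr hx)
  -- a term of maximal valuation
  obtain ⟨j, hj, hmax⟩ := Finset.exists_max_image s (fun i => valuation K (t i)) ⟨f.natDegree, hd⟩
  have htj : valuation K (t j) ≠ 0 := fun h0 => htd (le_antisymm (h0 ▸ hmax _ hd) zero_le)
  -- a second term with the same valuation
  have key : ∃ i ∈ s, i ≠ j ∧ valuation K (t i) = valuation K (t j) := by
    by_contra hne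
    have hlt : ∀ i ∈ s \ {j}, valuation K (t i) < valuation K (t j) := fun i hi => by
      rw [Finset.mem_sdiff, Finset.mem_singleton] at hi
      exact lt_of_le_of_ne (hmax i hi.1) fun heq => hne ⟨i, hi.1, hi.2, heq⟩
    have h := Valuation.map_sum_eq_of_lt (valuation K) hj hlt
    rw [hsum, map_zero] at h
    exact htj h.symm
  obtain ⟨i, -, hij, hti⟩ := key
  -- both coefficients are nonzero
  have hcj : f.coeff j ≠ 0 := fun h0 => htj (by rw [ht]; simp only [h0, map_zero, zero_mul])
  have hti' : valuation K (t i) ≠ 0 := hti ▸ htj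
  have hci : f.coeff i ≠ 0 := fun h0 => hti' (by rw [ht]; simp only [h0, map_zero, zero_mul])
  -- `v(c_i) v(x)^i = v(c_j) v(x)^j` with `v(c) = v(p)^{ord c}`
  have hvx : valuation K x ≠ 0 := (Valuation.ne_zero_iff _).mpr hx
  have hvp : valuation K ((p : ℕ) : K) ≠ 0 := (Valuation.ne_zero_iff _).mpr natCast_p_ne_zero
  have heq : valuation K ((p : ℕ) : K) ^ (f.coeff i).valuation * valuation K x ^ i =
      valuation K ((p : ℕ) : K) ^ (f.coeff j).valuation * valuation K x ^ j := by
    rw [← valuation_algebraMap_eq_zpow hc hci, ← valuation_algebraMap_eq_zpow hc hcj, ← map_pow,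
      ← map_pow, ← map_mul, ← map_mul]
    exact hti
  rcases Nat.lt_or_gt_of_ne hij with hlt | hlt
  · -- `i < j`: `v(x)^(j-i) = v(p)^(ord c_i - ord c_j)`
    obtain ⟨n, hn⟩ := Nat.exists_eq_add_of_lt hlt
    obtain rfl : j = i + (n + 1) := by omega
    refine ⟨n + 1, Nat.succ_pos n, (f.coeff i).valuation - (f.coeff (i + (n + 1))).valuation, ?_⟩
    rw [pow_add, mul_comm (valuation K x ^ i), ← mul_assoc] at heq
    have h2 := mul_right_cancel₀ (pow_ne_zero _ hvx) heq
    rw [zpow_sub₀ hvp, eq_div_iff (zpow_ne_zero _ hvp), h2, mul_comm]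
  · -- `j < i`
    obtain ⟨n, hn⟩ := Nat.exists_eq_add_of_lt hlt
    obtain rfl : i = j + (n + 1) := by omega
    refine ⟨n + 1, Nat.succ_pos n, (f.coeff j).valuation - (f.coeff (j + (n + 1))).valuation, ?_⟩
    rw [pow_add, mul_comm (valuation K x ^ j), ← mul_assoc] at heq
    have h2 := mul_right_cancel₀ (pow_ne_zero _ hvx) heq.symm
    rw [zpow_sub₀ hvp, eq_div_iff (zpow_ne_zero _ hvp), h2, mul_comm]

/-- **Valuative endomorphisms of a finite extension of `ℚ_p` preserve the valuation.** For `K` finite over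
`ℚ_p` with compatible valuative relation and a ring endomorphism `σ` of `K` with `σ a ≤ᵥ σ b ↔ a ≤ᵥ b`
(t4's `IsValHom`, the arrows of `D₀`), `v_K(σ x) = v_K(x)`: with `v_K(x)^n = v_K(p)^k`, the elements `x^n`
and `p^k` have equal valuations, hence so do `σ(x)^n` and `σ(p^k) = p^k`, and `n`-th roots are unique in the
value group. This is the arithmetic content of "the monoid `End_D(A_D)` acts trivially on `Φ(A_D)`"
(FrdII p. 9). [cite: MochizukiFrdII2008, Thm 1.2 (i) p.9] -/
theorem valuation_map_eq_of_isValHom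
    (hc : ∀ a b : ℚ_[p], algebraMap ℚ_[p] K a ≤ᵥ algebraMap ℚ_[p] K b ↔ a ≤ᵥ b)
    (σ : K →+* K) (hσ : IsValHom σ) (x : K) : valuation K (σ x) = valuation K x := by
  rcases eq_or_ne x 0 with rfl | hx
  · rw [map_zero]
  obtain ⟨n, hn, k, hk⟩ := exists_pow_valuation_eq_zpow hc hx
  -- `x^n` and `p^k` have the same valuation, hence so do their images under `σ`
  have hq : valuation K (x ^ n) = valuation K (((p : ℕ) : K) ^ k) := by rw [map_pow, hk, map_zpow₀]
  have hq' : valuation K (σ (x ^ n)) = valuation K (σ (((p : ℕ) : K) ^ k)) := by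
    rw [← Valuation.veq_iff_eq, veq_def] at hq ⊢
    exact ⟨(hσ _ _).mpr hq.1, (hσ _ _).mpr hq.2⟩
  rw [map_pow, map_zpow₀, map_natCast, map_pow, ← hq, map_pow] at hq'
  exact (pow_left_inj₀ zero_le zero_le hn.ne').mp hq'

end PadicLocal

/-! ### Consequences for the base category `D₀ = PadicFld p` and the monoid `Φ₀` -/

namespace PadicFld

variable {p : ℕ} [Fact p.Prime]

/-- For an object `Spec K` of `PadicFld p` whose field is a finite extension of `ℚ_p` with its `p`-adic
valuation (the objects of `D₀` in print), every endomorphism `σ : Spec K → Spec K` acts as the identity on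
`ord(O_K^⊳) = O_K^⊳/O_K^×`: `σ(x)` and `x` differ by a unit. [cite: MochizukiFrdII2008, Thm 1.2 (i) p.9] -/
theorem ordIntMapOfHom_eq_id (X : PadicFld.{u} p) [Algebra ℚ_[p] X.K] [Module.Finite ℚ_[p] X.K]
    (hc : ∀ a b : ℚ_[p], algebraMap ℚ_[p] X.K a ≤ᵥ algebraMap ℚ_[p] X.K b ↔ a ≤ᵥ b) (σ : X ⟶ X) :
    ordIntMapOfHom σ.alg σ.isValHom = MonoidHom.id _ := by
  ext a
  obtain ⟨x, rfl⟩ := Associates.mk_surjective a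
  rw [ordIntMapOfHom_mk, MonoidHom.id_apply]
  apply ordIntToOrdUnits_injective
  rw [ordIntToOrdUnits_mk, ordIntToOrdUnits_mk]
  apply (QuotientGroup.eq (s := unitSubgroup X.K)).mpr
  rw [mem_unitSubgroup_iff, Units.val_mul, Units.val_inv_eq_inv_val, coe_intNonzeroToUnits,
    coe_intNonzeroToUnits, coe_intNonzeroMapOfHom, map_mul, map_inv₀,
    valuation_map_eq_of_isValHom hc σ.alg σ.isValHom]
  exact inv_mul_cancel₀ ((Valuation.ne_zero_iff _).mpr x.2.2)

/-- **`End_{D₀}(Spec K)` acts trivially on `Φ₀(Spec K) = ord(O_K^⊳) ⊗ ℝ_{≥0}`** for `K` a finite extension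
of `ℚ_p` with its `p`-adic valuation: `Φ₀(σ) = id` for every `σ : Spec K → Spec K` — the hypothesis `hT`
of the `Aut`-ample and `Aut^sub`-ample clauses of FrdII Thm. 1.2 (i) (file `PadicFrobenioidThm12TypesProofs`).
[cite: MochizukiFrdII2008, Thm 1.2 (i) p.9] -/
theorem phiZero_map_eq_id (X : PadicFld.{u} p) [Algebra ℚ_[p] X.K] [Module.Finite ℚ_[p] X.K]
    (hc : ∀ a b : ℚ_[p], algebraMap ℚ_[p] X.K a ≤ᵥ algebraMap ℚ_[p] X.K b ↔ a ≤ᵥ b) (σ : X ⟶ X) :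
    (phiZero.{u} p).map σ.op = 𝟙 _ := by
  apply CommMonCat.hom_ext
  change Realification.map (ordIntMapOfHom σ.alg σ.isValHom) = _
  rw [ordIntMapOfHom_eq_id X hc σ, realificationMap_id]
  rfl

end PadicFld

end PadicFrd

end Literature.AlgebraicGeometry.Frobenioids
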